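import Literature.MathematicalPhysics.QuantumManyBody.PeriodicBoseGas

/-!
# Route `BECGroundStateSOS`, crux `BoundaryTransferWeak` (stmt-AtomisticToContinuum-0827),
# line `rim-squeeze-monotone-coherence`: vocabulary of the rim ramp

Route-posited technical objects (D-0016 `<Route>…Defs` file) of the crux line
`Cruxes/BoundaryTransferWeak/Lines/rim_squeeze_monotone_coherence.lean` (crux-plan round 1, lead c3),
shared by the six stub files `BECGroundStateSOSBoundaryTransferWeak<Stub>.lean` and the assembly.

One stoquastic coupling path on ONE Hilbert space, from the torus to the Dirichlet cube: on the torus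
of side `L'` (fundamental cell `[0,L')³`) put `H_t = H^per + t · Σ_j w(x_j)` with the rim potential
`w = rimPot L' = 1_{∃ k, x_k ≥ L'/2}` (the complement, inside the cell, of the cube `[0, L'/2)³`) and
`t ∈ [0, ∞]`. At `t = 0` this is the periodic problem; at `t = ⊤` (periodic `C¹` states vanishing
a.e. on configurations with a particle in the rim) it is the Dirichlet problem of the cube of side
`L'/2`. The transported quantity is the occupation of the normalised indicator `coreMode L'` of the
core cube `C = (L'/8, 3L'/8)³` in the ground state of `H_t`, read through near-minimisers exactly as
`Literature.MathematicalPhysics.QuantumManyBody.BoseGas.condensateNumber` does (`sup_δ inf`).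

* `rimPot L'`, `coreMode L'` — the one-body rim potential and the normalised core mode;
* `rimEnergy w t Ψ = t ∫_{cell^N} (Σ_j w(x_j)) |Ψ|²`, `rampEnergy v w t Ψ = periodicEnergy v Ψ + rimEnergy w t Ψ`;
* `rampGroundStateEnergy v w t N L' = inf_Ψ rampEnergy`;
* `rampOccupation v w t N L' φ = sup_{δ>0} inf {cellOccupation N L' φ Ψ : rampEnergy Ψ ≤ E_t + δ}`;
* `coreOcc v t N ρ' = rampOccupation v (rimPot L') t N L' (coreMode L')`, `L' = sideLength ρ' N`.

Only `rfl`/`simp`-level unfolding lemmas are proved here (`rampEnergy_zero`,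
`rampGroundStateEnergy_zero`: at `t = 0` the ramp problem IS the periodic problem, so `coreOcc v 0 N ρ'`
quantifies over exactly the `δ`-near-minimisers the torus-BEC hypothesis `A(v)` speaks about). All
objects are standard (Schrödinger form plus a bounded non-negative one-body potential, `⊤` allowed as
the hard-wall endpoint; `ℝ≥0∞` arithmetic: `0 · x = 0`, `⊤ · 0 = 0`).
-/

noncomputable section

namespace Summit.AtomisticToContinuum.BoseEinsteinCondensation.RimSqueeze

open Literature.MathematicalPhysics.QuantumManyBody.BoseGas
open MeasureTheory Filter Set
open scoped ENNReal NNReal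

/-- The **rim potential** of the torus cell `[0,L')³`: the indicator (value `1`) of the seam layer
`{x : ∃ k, L'/2 ≤ x_k}`, whose complement inside the cell is the cube `[0, L'/2)³` (a bounded
non-negative one-body potential on `ℝ³`; only its values on the cell are ever integrated). [folklore] -/
def rimPot (L' : ℝ) : Space → ℝ≥0∞ :=
  {x : Space | ∃ k, L' / 2 ≤ x k}.indicator fun _ => 1

/-- The **core mode**: the `L²`-normalised indicator of the core cube `C = (L'/8, 3L'/8)³` (side
`L'/4`, the middle half of the Dirichlet cube `(0, L'/2)³`). [folklore] -/
def coreMode (L' : ℝ) : Space → ℂ :=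
  {x : Space | ∀ k, x k ∈ Ioo (L' / 8) (3 * L' / 8)}.indicator fun _ => ((Real.sqrt ((L' / 4) ^ 3))⁻¹ : ℂ)

/-- The **rim term** `t ∫_{cell^N} (Σ_j w(x_j)) |Ψ|²` of the ramp Hamiltonian, for a one-body
potential `w` and a coupling `t ∈ [0, ∞]` (for `t = ⊤` it is `0` iff the weighted rim mass vanishes,
`⊤` otherwise). [folklore] -/
def rimEnergy {N : ℕ} {L' : ℝ} (w : Space → ℝ≥0∞) (t : ℝ≥0∞) (Ψ : PeriodicTrialState N L') : ℝ≥0∞ :=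
  t * ∫⁻ X in cellN N L', (∑ j, w (X j)) * (‖Ψ.ψ X‖₊ : ℝ≥0∞) ^ 2

/-- The **quadratic form of the ramp Hamiltonian** `H_t = H^per + t Σ_j w(x_j)` on periodic `C¹`
trial states: `periodicEnergy v Ψ + rimEnergy w t Ψ`. [folklore] -/
def rampEnergy {N : ℕ} {L' : ℝ} (v : ℝ → ℝ≥0∞) (w : Space → ℝ≥0∞) (t : ℝ≥0∞)
    (Ψ : PeriodicTrialState N L') : ℝ≥0∞ :=
  periodicEnergy v Ψ + rimEnergy w t Ψ

/-- The **ground-state energy of the ramp Hamiltonian**, `E_t = inf_Ψ rampEnergy v w t Ψ` (infimum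
of the form over the periodic `C¹` core; `⊤` if `L' ≤ 0`). [folklore] -/
def rampGroundStateEnergy (v : ℝ → ℝ≥0∞) (w : Space → ℝ≥0∞) (t : ℝ≥0∞) (N : ℕ) (L' : ℝ) : ℝ≥0∞ :=
  ⨅ Ψ : PeriodicTrialState N L', rampEnergy v w t Ψ

/-- The **occupation of a cell mode `φ` in the ground state of `H_t`**, through near-minimisers:
`sup_{δ>0} inf {⟨φ, γ_Ψ φ⟩_cell : rampEnergy v w t Ψ ≤ E_t + δ}` (the honest reading, as in
`condensateNumber`: for a unique ground state it is the ground-state value, for a degenerate ground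
space the infimum over ground states). [folklore] -/
def rampOccupation (v : ℝ → ℝ≥0∞) (w : Space → ℝ≥0∞) (t : ℝ≥0∞) (N : ℕ) (L' : ℝ) (φ : Space → ℂ) :
    ℝ≥0∞ :=
  ⨆ (δ : ℝ≥0∞) (_ : 0 < δ), ⨅ (Ψ : PeriodicTrialState N L')
    (_ : rampEnergy v w t Ψ ≤ rampGroundStateEnergy v w t N L' + δ), cellOccupation N L' φ Ψ.ψ

/-- The **core occupation along the ramp**: `⟨χ_C, γ_t χ_C⟩` in the ground state of `H_t` on the
torus of density `ρ'` (side `L' = sideLength ρ' N`), rim = complement of the cube of side `L'/2`,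
core mode = normalised indicator of its middle half. [folklore] -/
def coreOcc (v : ℝ → ℝ≥0∞) (t : ℝ≥0∞) (N : ℕ) (ρ' : ℝ) : ℝ≥0∞ :=
  rampOccupation v (rimPot (sideLength ρ' N)) t N (sideLength ρ' N) (coreMode (sideLength ρ' N))

/-! ### Unfolding lemmas -/

/-- The rim term vanishes at coupling `t = 0` (`0 · x = 0` in `ℝ≥0∞`, even for `x = ⊤`). [folklore] -/
@[simp] theorem rimEnergy_zero {N : ℕ} {L' : ℝ} (w : Space → ℝ≥0∞) (Ψ : PeriodicTrialState N L') :
    rimEnergy w 0 Ψ = 0 := by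
  simp [rimEnergy]

/-- At `t = 0` the ramp form is the periodic form. [folklore] -/
@[simp] theorem rampEnergy_zero {N : ℕ} {L' : ℝ} (v : ℝ → ℝ≥0∞) (w : Space → ℝ≥0∞)
    (Ψ : PeriodicTrialState N L') : rampEnergy v w 0 Ψ = periodicEnergy v Ψ := by
  simp [rampEnergy]

/-- Hence at `t = 0` the ramp ground-state energy is the periodic one: `coreOcc v 0 N ρ'` is a
`sup_δ inf` over EXACTLY the periodic `δ`-near-minimisers. [folklore] -/
@[simp] theorem rampGroundStateEnergy_zero (v : ℝ → ℝ≥0∞) (w : Space → ℝ≥0∞) (N : ℕ) (L' : ℝ) :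
    rampGroundStateEnergy v w 0 N L' = periodicGroundStateEnergy v N L' := by
  simp [rampGroundStateEnergy, periodicGroundStateEnergy]

/-- The ramp form dominates the periodic form (the rim term is non-negative). [folklore] -/
theorem periodicEnergy_le_rampEnergy {N : ℕ} {L' : ℝ} (v : ℝ → ℝ≥0∞) (w : Space → ℝ≥0∞) (t : ℝ≥0∞)
    (Ψ : PeriodicTrialState N L') : periodicEnergy v Ψ ≤ rampEnergy v w t Ψ :=
  le_self_add

/-- The ramp form is monotone in the coupling `t`. [folklore] -/
theorem rampEnergy_mono {N : ℕ} {L' : ℝ} (v : ℝ → ℝ≥0∞) (w : Space → ℝ≥0∞) {s t : ℝ≥0∞} (h : s ≤ t)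
    (Ψ : PeriodicTrialState N L') : rampEnergy v w s Ψ ≤ rampEnergy v w t Ψ := by
  unfold rampEnergy rimEnergy
  gcongr

/-- The ramp ground-state energy is monotone in the coupling `t`. [folklore] -/
theorem rampGroundStateEnergy_mono (v : ℝ → ℝ≥0∞) (w : Space → ℝ≥0∞) {s t : ℝ≥0∞} (h : s ≤ t)
    (N : ℕ) (L' : ℝ) : rampGroundStateEnergy v w s N L' ≤ rampGroundStateEnergy v w t N L' :=
  iInf_mono fun Ψ => rampEnergy_mono v w h Ψ

/-- Variational principle for the ramp problem. [folklore] -/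
theorem rampGroundStateEnergy_le {N : ℕ} {L' : ℝ} (v : ℝ → ℝ≥0∞) (w : Space → ℝ≥0∞) (t : ℝ≥0∞)
    (Ψ : PeriodicTrialState N L') : rampGroundStateEnergy v w t N L' ≤ rampEnergy v w t Ψ :=
  iInf_le _ Ψ

/-- How a floor on `rampOccupation` is PROVED: exhibit a slack `δ > 0` and a uniform lower bound on the
occupation over all `δ`-near-minimisers of the ramp form (pattern of `le_condensateNumber`). [folklore] -/
theorem le_rampOccupation {N : ℕ} {L' : ℝ} (v : ℝ → ℝ≥0∞) (w : Space → ℝ≥0∞) (t : ℝ≥0∞)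
    (φ : Space → ℂ) {δ m : ℝ≥0∞} (hδ : 0 < δ)
    (h : ∀ Ψ : PeriodicTrialState N L', rampEnergy v w t Ψ ≤ rampGroundStateEnergy v w t N L' + δ →
      m ≤ cellOccupation N L' φ Ψ.ψ) :
    m ≤ rampOccupation v w t N L' φ :=
  le_iSup₂_of_le (f := fun δ _ => ⨅ (Ψ : PeriodicTrialState N L')
      (_ : rampEnergy v w t Ψ ≤ rampGroundStateEnergy v w t N L' + δ), cellOccupation N L' φ Ψ.ψ) δ hδ
    (le_iInf₂ h)

/-- How a floor on `rampOccupation` is USED: every `δ`-near-minimiser bounds the `δ`-level infimum from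
above (pattern of `iInf_maxOccupation_le`). [folklore] -/
theorem iInf_cellOccupation_le {N : ℕ} {L' : ℝ} (v : ℝ → ℝ≥0∞) (w : Space → ℝ≥0∞) (t : ℝ≥0∞)
    (φ : Space → ℂ) {δ : ℝ≥0∞} (Ψ : PeriodicTrialState N L')
    (h : rampEnergy v w t Ψ ≤ rampGroundStateEnergy v w t N L' + δ) :
    ⨅ (Φ : PeriodicTrialState N L') (_ : rampEnergy v w t Φ ≤ rampGroundStateEnergy v w t N L' + δ),
        cellOccupation N L' φ Φ.ψ ≤ cellOccupation N L' φ Ψ.ψ :=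
  iInf₂_le Ψ h

/-- **`coreOcc` at `t = 0` is the periodic `sup_δ inf`**: the core occupation at the torus end of the
ramp quantifies over exactly the periodic `δ`-near-minimisers (the anchor lemma of this vocabulary file,
consumed by the torus core floor). [folklore] -/
theorem coreOcc_zero : ∀ (v : ℝ → ℝ≥0∞) (N : ℕ) (ρ' : ℝ), coreOcc v 0 N ρ' = ⨆ (δ : ℝ≥0∞) (_ : 0 < δ), ⨅ (Ψ : PeriodicTrialState N (sideLength ρ' N)) (_ : periodicEnergy v Ψ ≤ periodicGroundStateEnergy v N (sideLength ρ' N) + δ), cellOccupation N (sideLength ρ' N) (coreMode (sideLength ρ' N)) Ψ.ψ := by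
  intro v N ρ'
  simp only [coreOcc, rampOccupation, rampEnergy_zero, rampGroundStateEnergy_zero]

/-! ### Measurability and normalisation of the ramp vocabulary -/

/-- The rim set `{x : ∃ k, L'/2 ≤ x_k}` is measurable (a finite union of closed half-spaces).
[folklore] -/
theorem measurableSet_rim (L' : ℝ) : MeasurableSet {x : Space | ∃ k, L' / 2 ≤ x k} := by
  have : {x : Space | ∃ k, L' / 2 ≤ x k} = ⋃ k : Fin 3, (fun x : Space => x k) ⁻¹' Ici (L' / 2) := by
    ext x
    simp
  rw [this]
  exact MeasurableSet.iUnion fun k => measurableSet_Ici.preimage (by fun_prop)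

/-- The rim potential is measurable. [folklore] -/
theorem measurable_rimPot (L' : ℝ) : Measurable (rimPot L') :=
  measurable_const.indicator (measurableSet_rim L')

/-- The rim potential is bounded by `1`. [folklore] -/
theorem rimPot_le_one (L' : ℝ) (x : Space) : rimPot L' x ≤ 1 := by
  unfold rimPot
  by_cases hx : x ∈ {x : Space | ∃ k, L' / 2 ≤ x k}
  · simp [Set.indicator_of_mem hx]
  · simp [Set.indicator_of_notMem hx]

/-- Off the rim set the rim potential vanishes; on it, it is `1`. [folklore] -/
theorem rimPot_apply (L' : ℝ) (x : Space) :
    rimPot L' x = if ∃ k, L' / 2 ≤ x k then 1 else 0 := by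
  unfold rimPot
  by_cases hx : ∃ k, L' / 2 ≤ x k
  · rw [Set.indicator_of_mem (show x ∈ {x : Space | ∃ k, L' / 2 ≤ x k} from hx), if_pos hx]
  · rw [Set.indicator_of_notMem (show x ∉ {x : Space | ∃ k, L' / 2 ≤ x k} from hx), if_neg hx]

/-- The core cube `(L'/8, 3L'/8)³` is measurable. [folklore] -/
theorem measurableSet_core (L' : ℝ) :
    MeasurableSet {x : Space | ∀ k, x k ∈ Ioo (L' / 8) (3 * L' / 8)} := by
  have : {x : Space | ∀ k, x k ∈ Ioo (L' / 8) (3 * L' / 8)} =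
      ⋂ k : Fin 3, (fun x : Space => x k) ⁻¹' Ioo (L' / 8) (3 * L' / 8) := by
    ext x
    simp
  rw [this]
  exact MeasurableSet.iInter fun k => measurableSet_Ioo.preimage (by fun_prop)

/-- `|(L'/8, 3L'/8)³| = (L'/4)³` (Lebesgue measure on `EuclideanSpace ℝ (Fin 3)` is the product measure
transported by `WithLp.ofLp`; both sides are `0` for `L' ≤ 0`). [folklore] -/
theorem volume_core (L' : ℝ) :
    volume {x : Space | ∀ k, x k ∈ Ioo (L' / 8) (3 * L' / 8)} = ENNReal.ofReal (L' / 4) ^ 3 := by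
  have h : {x : Space | ∀ k, x k ∈ Ioo (L' / 8) (3 * L' / 8)} =
      (@WithLp.ofLp 2 (Fin 3 → ℝ)) ⁻¹' (Set.univ.pi fun _ => Ioo (L' / 8) (3 * L' / 8)) := by
    ext x
    simp
  rw [h, (PiLp.volume_preserving_ofLp (Fin 3)).measure_preimage
    (MeasurableSet.univ_pi fun _ => measurableSet_Ioo).nullMeasurableSet, volume_pi_pi]
  simp only [Real.volume_Ioo, Finset.prod_const, Finset.card_univ, Fintype.card_fin]
  congr 1
  congr 1
  ring

/-- The core mode is measurable. [folklore] -/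
theorem measurable_coreMode (L' : ℝ) : Measurable (coreMode L') :=
  measurable_const.indicator (measurableSet_core L')

/-- The core mode is a.e. strongly measurable (the form `occupation_le_maxOccupation` consumes). [folklore] -/
theorem aestronglyMeasurable_coreMode (L' : ℝ) : AEStronglyMeasurable (coreMode L') volume :=
  (measurable_coreMode L').aestronglyMeasurable

/-- Pointwise square modulus of the core mode: `|coreMode L' x|² = (L'/4)⁻³ · 1_C(x)`. [folklore] -/
theorem nnnorm_coreMode_sq (L' : ℝ) (hL : 0 < L') (x : Space) :
    ((‖coreMode L' x‖₊ : ℝ≥0∞) ^ 2) =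
      {x : Space | ∀ k, x k ∈ Ioo (L' / 8) (3 * L' / 8)}.indicator
        (fun _ => ENNReal.ofReal (((L' / 4) ^ 3)⁻¹)) x := by
  have hM3 : 0 < (L' / 4) ^ 3 := by positivity
  unfold coreMode
  by_cases hx : x ∈ {x : Space | ∀ k, x k ∈ Ioo (L' / 8) (3 * L' / 8)}
  · rw [Set.indicator_of_mem hx, Set.indicator_of_mem hx]
    rw [← ENNReal.coe_pow, ENNReal.ofReal, ENNReal.coe_inj]
    ext
    rw [NNReal.coe_pow, coe_nnnorm, norm_inv, Complex.norm_real,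
      Real.norm_of_nonneg (Real.sqrt_nonneg _), inv_pow, Real.sq_sqrt hM3.le,
      Real.coe_toNNReal _ (by positivity)]
  · rw [Set.indicator_of_notMem hx, Set.indicator_of_notMem hx]
    simp

/-- **The core mode is `L²`-normalised** for `L' > 0`: `∫ |coreMode L'|² = (L'/4)⁻³ · |C| = 1`. [folklore] -/
theorem lintegral_coreMode_sq {L' : ℝ} (hL : 0 < L') :
    ∫⁻ x, (‖coreMode L' x‖₊ : ℝ≥0∞) ^ 2 = 1 := by
  have hM3 : 0 < (L' / 4) ^ 3 := by positivity
  simp_rw [nnnorm_coreMode_sq L' hL]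
  rw [lintegral_indicator (measurableSet_core _), setLIntegral_const, volume_core,
    ← ENNReal.ofReal_pow (by positivity : (0:ℝ) ≤ L' / 4), ← ENNReal.ofReal_mul (by positivity),
    inv_mul_cancel₀ hM3.ne', ENNReal.ofReal_one]

/-- The core cube lies inside the cell `[0, L')³` (for `L' > 0`), so the cell cut-off of the core
mode is the core mode itself: `1_cell · coreMode = coreMode`. [folklore] -/
theorem indicator_cell_coreMode {L' : ℝ} (hL : 0 < L') :
    (cell L').indicator (coreMode L') = coreMode L' := by
  funext x
  by_cases hx : x ∈ {x : Space | ∀ k, x k ∈ Ioo (L' / 8) (3 * L' / 8)}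
  · have hxc : x ∈ cell L' := by
      intro k
      have := hx k
      constructor <;> nlinarith [this.1, this.2]
    rw [Set.indicator_of_mem hxc]
  · have : coreMode L' x = 0 := by
      unfold coreMode
      rw [Set.indicator_of_notMem hx]
    by_cases hxc : x ∈ cell L'
    · rw [Set.indicator_of_mem hxc]
    · rw [Set.indicator_of_notMem hxc, this]

/-- The core occupation at side `L'` is the plain `occupation` of the core mode in the cell cut-off of
the wave function (the cell indicator on the mode is redundant). [folklore] -/
theorem cellOccupation_coreMode {N : ℕ} {L' : ℝ} (hL : 0 < L') (Ψ : Config N → ℂ) :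
    cellOccupation N L' (coreMode L') Ψ = occupation N (coreMode L') ((cellN N L').indicator Ψ) := by
  rw [cellOccupation, indicator_cell_coreMode hL]

end Summit.AtomisticToContinuum.BoseEinsteinCondensation.RimSqueeze

end
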